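import Summits.BirchSwinnertonDyer.BirchSwinnertonDyer.Theorems.AlignedTransportAtTwoMainConjectureTransportAlignedAtTwoBothAddMeasure
import Literature.NumberTheory.EllipticCurves.PAdicLFunctionTameDepletionCongruenceAtTwoSharedPrimesProofs
import Literature.NumberTheory.EllipticCurves.RootNumberAtkinLehnerSemistableProofs
import Literature.NumberTheory.EllipticCurves.CuspFormLFunctionLevelConductorProofs
import Literature.NumberTheory.DiophantineGeometry.LocalReduction
import HarnessLib

/-!
# Route `AlignedTransportAtTwo`, crux C1 `MainConjectureTransportAlignedAtTwo` (stmt-BirchSwinnertonDyer-22296), line `birth` —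
# the BOTH-ADDITIVE twist leg, part 3 (CONGRUENCE): `L₂(f,α,χ) ≡ u·L₂(f,α)·∏_{v∈S₀}𝒫_v (mod 2Λ)` at a tame level `ℓ·m` through an
# ADDITIVE prime `ℓ` of the curve (`ℓ² ∣ N`), for an even quadratic `χ` non-trivial on the units `≡ 1 (mod ℓ)`

HONEST FRAMING (cell `bsd-f1-sign2`, lead seat `bsd-line-att-p1` g8). BSD is NOT proved; C1 is NOT closed. THEOREMS ONLY; nothing asserted;
`--supports stmt-BirchSwinnertonDyer-22296 --as helper`. Parts 1–2: `…BothAddSymbol`, `…BothAddMeasure`.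

* §1 `exists_iwasawa_padicLFunctionTame_one_congr_two_anyPlaces` — the DEPLETION half at an arbitrary finite set `S₀` of odd places (good,
  multiplicative OR ADDITIVE): `L₂(f,α,𝟙_m) = G₁ ∈ Λ`, `G₁ ≡ u·L_W·∏𝒫_v (mod 2)`; at an additive place `a_ℓ = 0`, Matsuno's factor is the unit
  `−(1+T)^{f_ℓ}` and `𝒫_v = 1` (the tree's `…_sqfreeAt` theorem with its additive branch added; the level-change identity
  `iwasawaToPowerSeries_prod_tameEulerFactor_mul_sqfreeAt` already allows every `ℓ ∣ N`).
* §2 `norm_padicLRiemannSumTame_sub_one_le_bothAddv`, `exists_iwasawa_pair_map_toZMod_eq_two_bothAddv` — the CHARACTER half at level `ℓm`: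
  the `(χ − 𝟙)`-isotypic cell estimate of part 2, doubled over `Δ = {±1}`, bounds the Riemann-sum differences by `½`; with `L₂(f,α,𝟙_{ℓm}) ∈ Λ`
  this puts `L₂(f,α,χ)` in `Λ` and congruent to it mod `2`.
* §3 `exists_iwasawa_padicLFunctionTame_congr_two_bothAddv` — both halves: `L₂(f,α,χ) ≡ u·L₂(f,α)·∏_{v∈S₀}𝒫_v (mod 2Λ)`.

References: [Matsuno2000] Lemmas 3.2–3.3, proof of Thm. 3.1; [GreenbergVatsal2000] §1 (8), §2 Prop. (2.4); [MazurTateTeitelbaum1986Invent] §I.10–I.13.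
-/

set_option autoImplicit false
set_option linter.dupNamespace false

noncomputable section

open scoped Classical MatrixGroups ModularForm

open Filter Topology NumberField IsDedekindDomain WeierstrassCurve CongruenceSubgroup PowerSeries
  Literature.NumberTheory.EllipticCurves Literature.NumberTheory.EllipticCurves.ModularForms
  Literature.NumberTheory.EllipticCurves.GreenbergVatsal2000
open Summit.BirchSwinnertonDyer.BirchSwinnertonDyer.Theorems.AlignedTransportAtTwoBothAddMeasure

namespace Summit.BirchSwinnertonDyer.BirchSwinnertonDyer.Theorems.AlignedTransportAtTwoBothAddCongruence

variable {N : ℕ} [NeZero N] {f : CuspForm (Gamma0 N) 2} (W : WeierstrassCurve ℚ) [W.IsElliptic] [W.IsGloballyMinimal]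

/-! ## §1 The depletion half at an arbitrary finite set of odd places -/

/-- Distinct finite places of `ℚ` lie over distinct primes; private helper. [folklore] -/
private theorem natGenerator_injective_rat' :
    Function.Injective (Rat.HeightOneSpectrum.natGenerator (R := 𝓞 ℚ)) := fun _ _ h ↦
  (Rat.HeightOneSpectrum.primesEquiv (R := 𝓞 ℚ)).injective (Subtype.ext h)

/-- `−(1+T)^{c}` is a unit of `Λ`; private helper. [folklore] -/
private theorem isUnit_neg_binomialSeries' {p : ℕ} [Fact p.Prime] (c : ℤ_[p]) :
    IsUnit (-PowerSeries.binomialSeries ℤ_[p] c) := by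
  refine (isUnit_iff_exists_inv.mpr ⟨PowerSeries.binomialSeries ℤ_[p] (-c), ?_⟩).neg
  rw [← PowerSeries.binomialSeries_add, add_neg_cancel, PowerSeries.binomialSeries_zero]

/-- **The `m`-depleted `2`-adic `L`-function vs `L₂(E)·∏𝒫_v` modulo `2`, at ANY finite set of odd places** (good, multiplicative or
ADDITIVE): for `E = W/ℚ` globally minimal, good ordinary at `2`, `f` its newform (level `N`), `S₀` a finite set of odd places and `m = ∏ ℓ_v`,
there are `L_W, G₁ ∈ Λ`, `u ∈ Λˣ` with `ι L_W = L₂(f,α)`, `ι G₁ = L₂(f,α,𝟙_m)`, `G₁ ≡ u·L_W·∏_{v∈S₀}𝒫_v (mod 2)`. Matsuno's Lemma 3.3 iterated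
(`iwasawaToPowerSeries_prod_tameEulerFactor_mul_sqfreeAt`, factors `h_ℓ = a_ℓ − (1+T)^{f_ℓ} − [ℓ ∤ N](1+T)^{−f_ℓ}`) with `𝒫_v ≡ −(1+T)^{f_ℓ}h_ℓ`
at good `v`, `𝒫_v ≡ h_ℓ` at multiplicative `v` (tree), and at an ADDITIVE `v`: `a_ℓ = 0`, `ℓ ∣ N`, `h_ℓ = −(1+T)^{f_ℓ}` a unit and `𝒫_v = 1`
(`localPolynomialAt_of_hasAdditiveReductionAt`). The companion of the tree's `…_one_congr_two_sqfreeAt`.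
[cite: Matsuno2000, Lemma 3.3 and proof of Theorem 3.1 (pp. 87–88)] [cite: GreenbergVatsal2000, §1 p. 9 (display (8)) and §2 Prop. (2.4)] -/
theorem exists_iwasawa_padicLFunctionTame_one_congr_two_anyPlaces (hord : IsOrdinaryAt W 2) (hf : IsNewformOf W f)
    (S₀ : Finset (HeightOneSpectrum (𝓞 ℚ))) (hS2 : ∀ v ∈ S₀, Rat.HeightOneSpectrum.natGenerator v ≠ 2)
    {m : ℕ} [NeZero m] (hm : m = ∏ v ∈ S₀, Rat.HeightOneSpectrum.natGenerator v) :
    ∃ (LW G₁ : IwasawaAlgebra 2) (u : (IwasawaAlgebra 2)ˣ),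
      iwasawaToPowerSeries 2 LW = padicLFunction f (unitRoot W 2 : ℚ_[2]) ∧
      iwasawaToPowerSeries 2 G₁ = padicLFunctionTame f m (unitRoot W 2 : ℚ_[2]) 1 ∧
      PowerSeries.map (PadicInt.toZMod (p := 2)) G₁ =
        PowerSeries.map (PadicInt.toZMod (p := 2)) ((u : IwasawaAlgebra 2) * LW * eulerFactorProduct W 2 S₀) := by
  obtain ⟨LW, hLW⟩ := exists_iwasawaToPowerSeries_eq_padicLFunction_two_auto hord hf
  obtain ⟨hαeq, hαu, -⟩ := unitRoot_coe_spec (W := W) hord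
  have hpN : ¬ 2 ∣ N := not_dvd_level_of_isNewformOf hf hord.1
  have hprime : ∀ v : HeightOneSpectrum (𝓞 ℚ), (Rat.HeightOneSpectrum.natGenerator v).Prime := fun v ↦
    (Rat.HeightOneSpectrum.primesEquiv v).2
  have hcop : ∀ v ∈ S₀, (Rat.HeightOneSpectrum.natGenerator v).Coprime 2 := fun v hv ↦
    (Nat.coprime_primes (hprime v) Nat.prime_two).mpr (hS2 v hv)
  -- the coefficients `a ℓ = a_ℓ(E)` (the Dirichlet coefficient at the primes of the level, the Frobenius trace elsewhere)
  set a : ℕ → ℤ := fun ℓ ↦ if ℓ ∣ N then W.LFunction ℓ else W.frobeniusTrace ℓ with hadef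
  set teich : ℕ → rootsOfUnity (torsionOrder 2) ℤ_[2] := fun ℓ ↦
    if h : ℓ.Coprime 2 then Classical.choose (exists_teichmuller_frobeniusExponent 2 h) else 1 with hteich
  have hc : ∀ ℓ ∈ S₀.image Rat.HeightOneSpectrum.natGenerator, ∀ n : ℕ,
      PadicInt.toZModPow (n + cyclotomicExponent 2) ((teich ℓ : ℤ_[2]ˣ) : ℤ_[2]) *
        (cyclotomicGenerator 2 : ZMod (2 ^ (n + cyclotomicExponent 2))) ^
          (PadicInt.toZModPow n ((fun ℓ : ℕ ↦ frobeniusExponent 2 (ℓ : ℤ_[2])) ℓ)).val =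
          (ℓ : ZMod (2 ^ (n + cyclotomicExponent 2))) := by
    intro ℓ hℓ n
    obtain ⟨v, hv, rfl⟩ := Finset.mem_image.mp hℓ
    have h := hcop v hv
    simp only [hteich, dif_pos h]
    exact Classical.choose_spec (exists_teichmuller_frobeniusExponent 2 h) n
  have hS : ∀ ℓ ∈ S₀.image Rat.HeightOneSpectrum.natGenerator, ℓ.Prime ∧ ℓ.Coprime 2 := by
    intro ℓ hℓ
    obtain ⟨v, hv, rfl⟩ := Finset.mem_image.mp hℓ
    exact ⟨hprime v, hcop v hv⟩
  have ha : ∀ ℓ ∈ S₀.image Rat.HeightOneSpectrum.natGenerator, cuspCoeff f ℓ = ((a ℓ : ℤ) : ℂ) := by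
    intro ℓ hℓ
    obtain ⟨v, hv, rfl⟩ := Finset.mem_image.mp hℓ
    haveI : Fact (Rat.HeightOneSpectrum.natGenerator v).Prime := ⟨hprime v⟩
    by_cases hN : Rat.HeightOneSpectrum.natGenerator v ∣ N
    · rw [hadef]; simp only [if_pos hN]; exact hf.2 _
    · rw [hadef]; simp only [if_neg hN]
      have hgp : W.HasGoodReductionAtPrime (Rat.HeightOneSpectrum.natGenerator v) := by
        by_contra hng
        exact hN ((hf.dvd_level_iff_dvd_conductorNorm (hprime v)).mpr
          ((W.dvd_conductorNorm_iff_not_hasGoodReductionAtPrime _).mpr hng))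
      exact cuspCoeff_eq_frobeniusTrace_of_isNewformOf_holds hf hgp
  have hinj : ∀ v ∈ S₀, ∀ w ∈ S₀,
      Rat.HeightOneSpectrum.natGenerator v = Rat.HeightOneSpectrum.natGenerator w → v = w :=
    fun v _ w _ h ↦ natGenerator_injective_rat' h
  have hm' : m = ∏ ℓ ∈ S₀.image Rat.HeightOneSpectrum.natGenerator, ℓ := by
    rw [hm, Finset.prod_image hinj]
  have hG₁ := iwasawaToPowerSeries_prod_tameEulerFactor_mul_sqfreeAt hf.1 hf.coeffField_eq_bot hpN
    (cuspCoeff_eq_frobeniusTrace_of_isNewformOf_holds hf hord.1) hαeq hαu (a := a)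
    (teich := teich) (c := fun ℓ : ℕ ↦ frobeniusExponent 2 (ℓ : ℤ_[2])) hS ha hc hm' hLW
  -- the unit: `−(1+T)^{−f_ℓ}` at the good places, `1` at the multiplicative ones, `−(1+T)^{f_ℓ}` at the additive ones
  set uv : HeightOneSpectrum (𝓞 ℚ) → (IwasawaAlgebra 2)ˣ := fun v ↦
    if W.HasAdditiveReductionAt v then
      (isUnit_neg_binomialSeries' (frobeniusExponent 2 (Rat.HeightOneSpectrum.natGenerator v : ℤ_[2]))).unit
    else if Rat.HeightOneSpectrum.natGenerator v ∣ N then 1 else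
      (isUnit_neg_binomialSeries' (-frobeniusExponent 2 (Rat.HeightOneSpectrum.natGenerator v : ℤ_[2]))).unit with huv
  -- per place: `u_v 𝒫_v ≡ h_ℓ (mod 2)`
  have key : ∀ v ∈ S₀, PowerSeries.map (PadicInt.toZMod (p := 2))
      (C ((a (Rat.HeightOneSpectrum.natGenerator v) : ℤ) : ℤ_[2]) -
        PowerSeries.binomialSeries ℤ_[2] (frobeniusExponent 2 (Rat.HeightOneSpectrum.natGenerator v : ℤ_[2])) -
        (if Rat.HeightOneSpectrum.natGenerator v ∣ N then 0 else
          PowerSeries.binomialSeries ℤ_[2] (-frobeniusExponent 2 (Rat.HeightOneSpectrum.natGenerator v : ℤ_[2])))) =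
      PowerSeries.map (PadicInt.toZMod (p := 2)) ((uv v : IwasawaAlgebra 2) * eulerFactorElement W 2 v) := by
    intro v hv
    haveI : Fact (Rat.HeightOneSpectrum.natGenerator v).Prime := ⟨hprime v⟩
    rcases W.hasGoodReductionAt_or_hasMultiplicativeReductionAt_or_hasAdditiveReductionAt v with hg | hmul | hadd
    · -- good place
      have hgp : W.HasGoodReductionAtPrime (Rat.HeightOneSpectrum.natGenerator v) :=
        (hasGoodReductionAtPrime_iff_hasGoodReductionAt_ringOfIntegers v W).mpr hg
      have hℓN : ¬ Rat.HeightOneSpectrum.natGenerator v ∣ N := not_dvd_level_of_isNewformOf hf hgp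
      have hnadd : ¬ W.HasAdditiveReductionAt v := fun h ↦ h.not_hasGoodReduction _ hg
      have hE := map_toZMod_eulerFactorElement_two_eq W v hg (hcop v hv)
      rw [frobeniusTraceAt_eq_frobeniusTrace] at hE
      have huv_val : ((uv v : (IwasawaAlgebra 2)ˣ) : IwasawaAlgebra 2) =
          -PowerSeries.binomialSeries ℤ_[2] (-frobeniusExponent 2 (Rat.HeightOneSpectrum.natGenerator v : ℤ_[2])) := by
        rw [huv]; simp only [if_neg hnadd, if_neg hℓN]; exact IsUnit.unit_spec _
      have haℓ : a (Rat.HeightOneSpectrum.natGenerator v) = W.frobeniusTrace (Rat.HeightOneSpectrum.natGenerator v) := by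
        rw [hadef]; simp only [if_neg hℓN]
      rw [if_neg hℓN, haℓ, map_mul, hE, ← map_mul, huv_val, frobeniusSeries_eq, ← mul_assoc, neg_mul_neg,
        ← PowerSeries.binomialSeries_add, neg_add_cancel, PowerSeries.binomialSeries_zero, one_mul]
      congr 1
      show _ = C ((W.frobeniusTrace (Rat.HeightOneSpectrum.primesEquiv v) : ℤ) : ℤ_[2]) - _ - _
      have : (Rat.HeightOneSpectrum.primesEquiv v : ℕ) = Rat.HeightOneSpectrum.natGenerator v := rfl
      rw [this]
      ring
    · -- multiplicative place
      have hmp : W.HasMultiplicativeReductionAtPrime (Rat.HeightOneSpectrum.natGenerator v) :=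
        (W.hasMultiplicativeReductionAtPrime_iff_hasMultiplicativeReductionAt_ringOfIntegers v).mpr hmul
      obtain ⟨hℓN, -, -⟩ := hf.dvd_level_and_not_sq_dvd_of_multiplicative hmp
      have hnadd : ¬ W.HasAdditiveReductionAt v := fun h ↦ h.not_hasMultiplicativeReduction _ hmul
      have huv_val : ((uv v : (IwasawaAlgebra 2)ˣ) : IwasawaAlgebra 2) = 1 := by
        rw [huv]; simp only [if_neg hnadd, if_pos hℓN, Units.val_one]
      have ha1 : a (Rat.HeightOneSpectrum.natGenerator v) = 1 ∨ a (Rat.HeightOneSpectrum.natGenerator v) = -1 := by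
        rw [hadef]
        simp only [if_pos hℓN]
        by_cases hs : W.HasSplitMultiplicativeReductionAtPrime (Rat.HeightOneSpectrum.natGenerator v)
        · left
          have h := (hf.cuspCoeff_eq_one_and_sq_of_split hs).1
          rw [hf.2] at h; exact_mod_cast h
        · right
          have h := (hf.cuspCoeff_eq_neg_one_and_dvd_of_nonsplit hmp hs).1
          rw [hf.2] at h; exact_mod_cast h
      rw [if_pos hℓN, sub_zero, huv_val, one_mul,
        map_toZMod_eulerFactorElement_two_eq_of_hasMultiplicativeReductionAt W v hmul (hcop v hv) ha1, frobeniusSeries_eq]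
    · -- additive place: `a_ℓ = 0`, `ℓ ∣ N`, `𝒫_v = 1`
      have hℓN : Rat.HeightOneSpectrum.natGenerator v ∣ N :=
        (hf.dvd_level_iff_dvd_conductorNorm (hprime v)).mpr
          ((W.dvd_conductorNorm_iff_not_hasGoodReductionAtPrime _).mpr fun hg ↦ hadd.not_hasGoodReduction _
            ((hasGoodReductionAtPrime_iff_hasGoodReductionAt_ringOfIntegers v W).mp hg))
      have huv_val : ((uv v : (IwasawaAlgebra 2)ˣ) : IwasawaAlgebra 2) =
          -PowerSeries.binomialSeries ℤ_[2] (frobeniusExponent 2 (Rat.HeightOneSpectrum.natGenerator v : ℤ_[2])) := by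
        rw [huv]; simp only [if_pos hadd]; exact IsUnit.unit_spec _
      have ha0 : a (Rat.HeightOneSpectrum.natGenerator v) = 0 := by
        rw [hadef]; simp only [if_pos hℓN]
        exact W.LFunction_apply_primesEquiv_of_hasAdditiveReductionAt hadd
      have hP : eulerFactorElement W 2 v = 1 := by
        rw [eulerFactorElement, W.localPolynomialAt_of_hasAdditiveReductionAt hadd, map_one]
      rw [if_pos hℓN, sub_zero, ha0, huv_val, hP, mul_one, Int.cast_zero, map_zero, zero_sub]
  refine ⟨LW, _, ∏ v ∈ S₀, uv v, hLW, hG₁, ?_⟩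
  rw [Finset.prod_image hinj, map_mul, map_prod, Finset.prod_congr rfl key, Units.coe_prod, eulerFactorProduct_eq,
    map_mul, map_mul, map_prod, map_prod]
  simp only [map_mul]
  rw [Finset.prod_mul_distrib]
  ring

/-! ## §2 The character half at a tame level `ℓ·m` through an additive prime -/

section Character

variable {ℓ m : ℕ} [NeZero ℓ] [NeZero m] [NeZero (ℓ * m)]

omit [NeZero ℓ] [NeZero m] [NeZero (ℓ * m)] in
/-- The trivial character mod `ℓm` is even; private helper. [folklore] -/
private theorem even_one' : (1 : DirichletCharacter ℚ_[2] (ℓ * m)).Even := by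
  show (1 : DirichletCharacter ℚ_[2] (ℓ * m)) (-1) = 1
  rw [show (-1 : ZMod (ℓ * m)) = (((-1 : (ZMod (ℓ * m))ˣ) : (ZMod (ℓ * m))ˣ) : ZMod (ℓ * m)) by simp, MulChar.one_apply_coe]

/-- **The Riemann sums of `L₂(f,α,χ)` and `L₂(f,α,𝟙_{ℓm})` differ by at most `‖2‖`** at a tame level `ℓm` through an additive prime `ℓ` of the
level (`ℓ² ∣ N`, `a_ℓ = 0`), `(m, 2N) = 1`, `m > 2`, for an EVEN quadratic `χ` with a witness `h₀ ≡ 1 (mod ℓ)`, `χ(h₀) ≠ 1`: both sums are doubled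
`η = 1` halves (`padicLRiemannSumTame_two_of_even`), and each `(χ − 𝟙)`-isotypic cell sum has norm `≤ 1` (part 2,
`norm_sum_sub_one_mul_msdMeasureTame_le_one`). [cite: Matsuno2000, Lemma 3.2 (p. 87), proof] [cite: MazurTateTeitelbaum1986Invent, §I.13] -/
theorem norm_padicLRiemannSumTame_sub_one_le_bothAddv (hf : IsNewform0 f) (hQ : coeffField f = ⊥) (hℓ : ℓ.Prime)
    (hℓN : ℓ ^ 2 ∣ N) (h2N : ¬ 2 ∣ N) (hmN : m.Coprime N) (hm2 : ¬ 2 ∣ m) (hm3 : 2 < m) (haℓ : cuspCoeff f ℓ = 0)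
    {a₂ : ℤ} (ha₂ : cuspCoeff f 2 = a₂) {α : ℚ_[2]} (hα : ‖α⁻¹‖ ≤ 1) (hroot : α ^ 2 - a₂ * α + 2 = 0)
    (χ : DirichletCharacter ℚ_[2] (ℓ * m)) (hχ : χ.Even) (hsq : χ ^ 2 = 1) (h₀ : (ZMod (ℓ * m))ˣ)
    (hh₀ : (ℓ : ℤ) ∣ ((h₀ : ZMod (ℓ * m)).val : ℤ) - 1) (hχh₀ : χ h₀ ≠ 1) (k n : ℕ) :
    ‖padicLRiemannSumTame f (ℓ * m) α χ k n - padicLRiemannSumTame f (ℓ * m) α 1 k n‖ ≤ ‖(2 : ℚ_[2])‖ := by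
  have hℓ2 : ℓ ≠ 2 := by rintro rfl; exact h2N (dvd_trans ⟨2, by norm_num⟩ hℓN)
  have hu2 : (ℓ * m).Coprime 2 :=
    Nat.Coprime.mul_left ((Nat.coprime_primes hℓ Nat.prime_two).mpr hℓ2)
      ((Nat.Prime.coprime_iff_not_dvd Nat.prime_two).mpr hm2).symm
  rw [padicLRiemannSumTame_two_of_even f hu2 α χ hχ, padicLRiemannSumTame_two_of_even f hu2 α 1 even_one', ← mul_sub,
    norm_mul, ← Finset.sum_sub_distrib]
  have hγ : ∀ s : ZMod (2 ^ n), IsUnit ((cyclotomicGenerator 2 : ZMod (2 ^ (n + 2))) ^ s.val) := fun s ↦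
    (isUnit_cyclotomicGenerator_cast (p := 2) (n + 2)).pow _
  have hcell : ∀ s : ZMod (2 ^ n),
      ‖∑ b : ZMod (ℓ * m), (χ b * msdMeasureTame f (ℓ * m) α (n + 2) ((cyclotomicGenerator 2 : ZMod (2 ^ (n + 2))) ^ s.val) b *
          (s.val.choose k : ℚ_[2]) -
        (1 : DirichletCharacter ℚ_[2] (ℓ * m)) b *
          msdMeasureTame f (ℓ * m) α (n + 2) ((cyclotomicGenerator 2 : ZMod (2 ^ (n + 2))) ^ s.val) b * (s.val.choose k : ℚ_[2]))‖ ≤ 1 := by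
    intro s
    have hc : ‖((s.val.choose k : ℕ) : ℚ_[2])‖ ≤ 1 := by
      have h := Padic.norm_int_le_one (p := 2) ((s.val.choose k : ℕ) : ℤ)
      rwa [Int.cast_natCast] at h
    have hfac : ∑ b : ZMod (ℓ * m), (χ b * msdMeasureTame f (ℓ * m) α (n + 2)
        ((cyclotomicGenerator 2 : ZMod (2 ^ (n + 2))) ^ s.val) b * (s.val.choose k : ℚ_[2]) -
        (1 : DirichletCharacter ℚ_[2] (ℓ * m)) b *
          msdMeasureTame f (ℓ * m) α (n + 2) ((cyclotomicGenerator 2 : ZMod (2 ^ (n + 2))) ^ s.val) b * (s.val.choose k : ℚ_[2])) =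
        (∑ b : ZMod (ℓ * m), (χ b - (1 : DirichletCharacter ℚ_[2] (ℓ * m)) b) *
          msdMeasureTame f (ℓ * m) α (n + 2) ((cyclotomicGenerator 2 : ZMod (2 ^ (n + 2))) ^ s.val) b) *
          (s.val.choose k : ℚ_[2]) := by
      rw [Finset.sum_mul]
      refine Finset.sum_congr rfl fun b _ ↦ ?_
      ring
    rw [hfac, norm_mul]
    calc _ ≤ 1 * 1 := mul_le_mul (norm_sum_sub_one_mul_msdMeasureTame_le_one (ℓ := ℓ) (m := m) hf hQ hℓ hℓN h2N hmN
          hm2 hm3 haℓ ha₂ hα hroot χ hsq h₀ hh₀ hχh₀ (n + 1) (hγ s)) hc (norm_nonneg _) zero_le_one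
      _ = 1 := one_mul _
  calc ‖(2 : ℚ_[2])‖ * ‖∑ s : ZMod (2 ^ n), _‖ ≤ ‖(2 : ℚ_[2])‖ * 1 := by
        gcongr
        exact IsUltrametricDist.norm_sum_le_of_forall_le_of_nonneg zero_le_one fun s _ ↦ by
          rw [← Finset.sum_sub_distrib]; exact hcell s
    _ = ‖(2 : ℚ_[2])‖ := mul_one _

variable {W}

/-- **`L₂(f,α,χ) ∈ Λ` and `L₂(f,α,χ) ≡ L₂(f,α,𝟙_{ℓm}) (mod 2Λ)` at a tame level through an additive prime**, given an integral lift `G₁` of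
`L₂(f,α,𝟙_{ℓm})` (§1): there is `G ∈ Λ` with `ι G = L₂(f,α,χ)` and `G ≡ G₁ (mod 2)` (limits of §2's Riemann sums; `exists_iwasawa_pair_map_toZMod_eq`).
[cite: Matsuno2000, Lemma 3.2 (p. 87)] [cite: MazurTateTeitelbaum1986Invent, §I.12 (p. 17)] -/
theorem exists_iwasawa_pair_map_toZMod_eq_two_bothAddv (hord : IsOrdinaryAt W 2) (hf : IsNewformOf W f) (hℓ : ℓ.Prime)
    (hℓN : ℓ ^ 2 ∣ N) (hmN : m.Coprime N) (hm2 : ¬ 2 ∣ m) (hm3 : 2 < m) (haℓ : cuspCoeff f ℓ = 0)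
    (χ : DirichletCharacter ℚ_[2] (ℓ * m)) (hχ : χ.Even) (hsq : χ ^ 2 = 1) (h₀ : (ZMod (ℓ * m))ˣ)
    (hh₀ : (ℓ : ℤ) ∣ ((h₀ : ZMod (ℓ * m)).val : ℤ) - 1) (hχh₀ : χ h₀ ≠ 1)
    {G₁ : IwasawaAlgebra 2} (hG₁ : iwasawaToPowerSeries 2 G₁ = padicLFunctionTame f (ℓ * m) (unitRoot W 2 : ℚ_[2]) 1) :
    ∃ G : IwasawaAlgebra 2, iwasawaToPowerSeries 2 G = padicLFunctionTame f (ℓ * m) (unitRoot W 2 : ℚ_[2]) χ ∧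
      PowerSeries.map (PadicInt.toZMod (p := 2)) G = PowerSeries.map (PadicInt.toZMod (p := 2)) G₁ := by
  obtain ⟨hαeq, hαu, -⟩ := unitRoot_coe_spec (W := W) hord
  have hα : ‖(unitRoot W 2 : ℚ_[2])⁻¹‖ ≤ 1 := by rw [norm_inv, hαu, inv_one]
  have h2N : ¬ 2 ∣ N := not_dvd_level_of_isNewformOf hf hord.1
  have hℓ2 : ℓ ≠ 2 := by rintro rfl; exact h2N (dvd_trans ⟨2, by norm_num⟩ hℓN)
  have hu2 : (ℓ * m).Coprime 2 :=
    Nat.Coprime.mul_left ((Nat.coprime_primes hℓ Nat.prime_two).mpr hℓ2)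
      ((Nat.Prime.coprime_iff_not_dvd Nat.prime_two).mpr hm2).symm
  have h2 : ‖(2 : ℚ_[2])‖ = (2 : ℝ)⁻¹ := by
    have h := Padic.norm_p (p := 2); simpa using h
  have hL1 : ∀ k, ‖PowerSeries.coeff k (padicLFunctionTame f (ℓ * m) (unitRoot W 2 : ℚ_[2]) 1)‖ ≤ 1 :=
    (exists_iwasawaToPowerSeries_eq_iff_norm_coeff_le_one _).mp ⟨G₁, hG₁⟩
  have hdiff : ∀ k, ‖padicLCoeffTame f (ℓ * m) (unitRoot W 2 : ℚ_[2]) χ k -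
      padicLCoeffTame f (ℓ * m) (unitRoot W 2 : ℚ_[2]) 1 k‖ ≤ ‖(2 : ℚ_[2])‖ := fun k ↦
    le_of_tendsto ((tendsto_padicLRiemannSumTame_unitRoot_two hord hf hu2 χ k).sub
      (tendsto_padicLRiemannSumTame_unitRoot_two hord hf hu2 1 k)).norm
      (Eventually.of_forall fun n ↦ norm_padicLRiemannSumTame_sub_one_le_bothAddv hf.1 hf.coeffField_eq_bot hℓ hℓN h2N
        hmN hm2 hm3 haℓ (cuspCoeff_eq_frobeniusTrace_of_isNewformOf_holds hf hord.1) hα hαeq χ hχ hsq h₀ hh₀ hχh₀ k n)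
  have hLχ : ∀ k, ‖PowerSeries.coeff k (padicLFunctionTame f (ℓ * m) (unitRoot W 2 : ℚ_[2]) χ)‖ ≤ 1 := by
    intro k
    have h1 := hL1 k
    rw [coeff_padicLFunctionTame] at h1 ⊢
    have hd := hdiff k
    rw [h2] at hd
    have heq : padicLCoeffTame f (ℓ * m) (unitRoot W 2 : ℚ_[2]) χ k =
        (padicLCoeffTame f (ℓ * m) (unitRoot W 2 : ℚ_[2]) χ k - padicLCoeffTame f (ℓ * m) (unitRoot W 2 : ℚ_[2]) 1 k) +
          padicLCoeffTame f (ℓ * m) (unitRoot W 2 : ℚ_[2]) 1 k := by ring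
    rw [heq]
    refine (Padic.nonarchimedean _ _).trans (max_le (hd.trans (by norm_num)) h1)
  obtain ⟨G, G₁', hG, hG₁', hGG⟩ := exists_iwasawa_pair_map_toZMod_eq _ _ hLχ hL1 (fun k ↦ by
    rw [coeff_padicLFunctionTame, coeff_padicLFunctionTame]
    have hd := hdiff k
    rw [h2] at hd
    linarith)
  have hEq : G₁' = G₁ := iwasawaToPowerSeries_injective 2 (hG₁'.trans hG₁.symm)
  exact ⟨G, hG, by rw [hGG, hEq]⟩

end Character

/-! ## §3 Both halves: the congruence at a tame level through an additive prime -/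

/-- **`L₂(f,α,χ) ≡ u·L₂(f,α)·∏_{v∈S₀}𝒫_v (mod 2Λ)` AT A TAME LEVEL `ℓ·m` THROUGH AN ADDITIVE PRIME `ℓ`.** For `E = W/ℚ` globally minimal, good
ordinary at `2`, `f` its newform of level `N` with `ℓ² ∣ N` (`ℓ` an odd prime with `a_ℓ(f) = 0`), `(m, 2N) = 1`, `m > 2`, `S₀` a finite set of odd
places with `∏ ℓ_v = ℓm`, and an EVEN QUADRATIC `ℚ₂`-valued character `χ` mod `ℓm` with a witness `h₀ ≡ 1 (mod ℓ)`, `χ(h₀) ≠ 1`: there are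
`L_W, G ∈ Λ`, `u ∈ Λˣ` with `ι L_W = L₂(f,α)`, `ι G = L₂(f,α,χ)`, `G ≡ u·L_W·∏_{v∈S₀}𝒫_v (mod 2)`. The tree's `…_congr_two_sqfreeAt` needs `ℓ² ∤ N`;
here the cell-wise bound is replaced by the isotypic estimate of part 2. [cite: Matsuno2000, Lemmas 3.2–3.3 and proof of Theorem 3.1 (pp. 87–88)]
[cite: GreenbergVatsal2000, §2 Prop. (2.4)] -/
theorem exists_iwasawa_padicLFunctionTame_congr_two_bothAddv {ℓ m : ℕ} [NeZero ℓ] [NeZero m] [NeZero (ℓ * m)]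
    (hord : IsOrdinaryAt W 2) (hf : IsNewformOf W f) (hℓ : ℓ.Prime)
    (hℓN : ℓ ^ 2 ∣ N) (hmN : m.Coprime N) (hm2 : ¬ 2 ∣ m) (hm3 : 2 < m) (haℓ : cuspCoeff f ℓ = 0)
    (S₀ : Finset (HeightOneSpectrum (𝓞 ℚ))) (hS2 : ∀ v ∈ S₀, Rat.HeightOneSpectrum.natGenerator v ≠ 2)
    (hS : ℓ * m = ∏ v ∈ S₀, Rat.HeightOneSpectrum.natGenerator v)
    (χ : DirichletCharacter ℚ_[2] (ℓ * m)) (hχ : χ.Even) (hsq : χ ^ 2 = 1) (h₀ : (ZMod (ℓ * m))ˣ)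
    (hh₀ : (ℓ : ℤ) ∣ ((h₀ : ZMod (ℓ * m)).val : ℤ) - 1) (hχh₀ : χ h₀ ≠ 1) :
    ∃ (LW G : IwasawaAlgebra 2) (u : (IwasawaAlgebra 2)ˣ),
      iwasawaToPowerSeries 2 LW = padicLFunction f (unitRoot W 2 : ℚ_[2]) ∧
      iwasawaToPowerSeries 2 G = padicLFunctionTame f (ℓ * m) (unitRoot W 2 : ℚ_[2]) χ ∧
      PowerSeries.map (PadicInt.toZMod (p := 2)) G =
        PowerSeries.map (PadicInt.toZMod (p := 2)) ((u : IwasawaAlgebra 2) * LW * eulerFactorProduct W 2 S₀) := by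
  obtain ⟨LW, G₁, u, hLW, hG₁, hcongr⟩ :=
    exists_iwasawa_padicLFunctionTame_one_congr_two_anyPlaces W hord hf S₀ hS2 (m := ℓ * m) hS
  obtain ⟨G, hG, hGG₁⟩ := exists_iwasawa_pair_map_toZMod_eq_two_bothAddv hord hf hℓ hℓN hmN hm2 hm3 haℓ χ hχ hsq h₀ hh₀ hχh₀ hG₁
  exact ⟨LW, G, u, hLW, hG, by rw [hGG₁, hcongr]⟩

end Summit.BirchSwinnertonDyer.BirchSwinnertonDyer.Theorems.AlignedTransportAtTwoBothAddCongruence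

end
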